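import Summits.QuantumFields.YangMills.Theorems.ParabolicTrajectoryLatticeGapOnTrajectoryTransferHankelTorus
import Literature.MathematicalPhysics.QuantumFieldTheory.SpeciesTimeReflection
import HarnessLib

/-!
# Crux `LatticeGapOnTrajectory` (stmt-QuantumFields-10523): reflection positivity of the ODD Wilson
# torus for the SITE reflection `t ↦ −t` (stub `stub_negReflectRP`, line orbit-kantorovich-finite-size)

Helper file (`--supports stmt-QuantumFields-10523`). On the torus `(ℤ/(2S+1))⁴` (`S ≥ 1`) the site
reflection `Θ₀ = GaugeConfig.negReflect` (`t ↦ −t`; fixed site plane `t = 0`, fixed link plane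
between the slices `S | S+1`) is conjugate to the link reflection `Θ₁ = GaugeConfig.timeReflect`
(`t ↦ 1 − t`; fixed link plane `0 | 1`, fixed site plane `t = S+1`) by the half-torus time shift
`τ = torusConfigShift (S e₀)` (`(τU)(x,i) = U(x − S e₀, i)`):

* `negRP_negReflect_halfShift` — `Θ₀ ∘ τ = τ ∘ Θ₁` (uses `2(S+1) ≡ 1 (mod 2S+1)`);
* `negRP_edgeReflect_mem` — the link map of `τ ∘ Θ₁` carries the `Θ₀`-positive links (spatial
  links based at times `0 … S`, temporal links based at times `0 … S−1`) into the `Θ₁`-positive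
  class `oPosEdges ∪ oSharedEdges` of the tree;
* **`wilsonExpectation_negReflect_nonneg_odd`** — `0 ≤ ∫ conj F(Θ₀U) F(U) dμ`, `μ = wilsonMeasure ρ β`
  (`β ≥ 0`, continuous `ρ`), for bounded measurable `F` depending only on the `Θ₀`-positive links:
  with `φ = τ ∘ Θ₁` (measure preserving) and `H = F ∘ φ` one has
  `conj F(Θ₀(φV)) F(φV) = conj H(Θ₁V) H(V)`, and the tree's
  `wilsonExpectation_oddReflectionPositive` applies to `H`;
* **`stub_negReflectRP`** — the slab form: `F` depending on the links based at times `1 … w`,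
  `w < S`.

The slab form with `w ≤ S` (temporal links `S → S+1` allowed) is FALSE: those links CROSS the
fixed link plane of `Θ₀`, `Θ₀U(x,0) = U(x,0)⁻¹` for `x⁰ = S`, so `F(U) = f(U(x,0))` with
`f(g⁻¹) = −f(g)` gives the integrand `−‖f(U(x,0))‖²` (e.g. `G = U(1)`, `f = Im`, `β = 0`:
expectation `−1/2`).
References: Osterwalder–Seiler 1978 §2; Seiler LNP 159 Ch. 2; Fröhlich–Israel–Lieb–Simon 1978 Thm. 2.1.
-/

open scoped ComplexConjugate ComplexOrder
open MeasureTheory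
open Literature.MathematicalPhysics.QuantumLattice Literature.MathematicalPhysics.QuantumFieldTheory

noncomputable section

namespace Summit.QuantumFields.YangMills.Cruxes.LatticeGapOnTrajectory.OrbitKantorovichFiniteSize

/-! ## §1 Geometry: the site reflection is the half-torus conjugate of the link reflection -/

section Geometry

variable {S : ℕ}

/-- `2(S+1) ≡ 1` on `ℤ/(2S+1)`: `−S = 1 + S`. [folklore] -/
theorem negRP_neg_half_eq : -((S : ℕ) : ZMod (2 * S + 1)) = 1 + S := by
  have h : ((2 * S + 1 : ℕ) : ZMod (2 * S + 1)) = 0 := ZMod.natCast_self _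
  push_cast at h
  linear_combination -h

/-- Spatial links: `θ₀ x − S e₀ = θ₁ (x − S e₀)` on the torus of side `2S+1`. [folklore] -/
theorem negRP_negReflect_sub_half (x : Site 4 (2 * S + 1)) :
    x.negReflect - Pi.single 0 ((S : ℕ) : ZMod (2 * S + 1)) =
      (x - Pi.single 0 ((S : ℕ) : ZMod (2 * S + 1))).timeReflect := by
  funext k
  by_cases hk : k = 0
  · subst hk
    simp only [Pi.sub_apply, WilsonSiteRP.negReflect_apply_zero, WilsonRP.timeReflect_apply_zero,
      Pi.single_eq_same]
    linear_combination (negRP_neg_half_eq (S := S))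
  · simp only [Pi.sub_apply, WilsonSiteRP.negReflect_apply_of_ne _ hk,
      WilsonRP.timeReflect_apply_of_ne _ hk, Pi.single_eq_of_ne hk, sub_zero]

/-- Temporal links: `θ₀ (x + e₀) − S e₀ = θ₁ (x − S e₀ + e₀)` on the torus of side `2S+1`.
[folklore] -/
theorem negRP_negReflect_shift_sub_half (x : Site 4 (2 * S + 1)) :
    (x.shift 0).negReflect - Pi.single 0 ((S : ℕ) : ZMod (2 * S + 1)) =
      ((x - Pi.single 0 ((S : ℕ) : ZMod (2 * S + 1))).shift 0).timeReflect := by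
  funext k
  by_cases hk : k = 0
  · subst hk
    simp only [Pi.sub_apply, WilsonSiteRP.negReflect_apply_zero, WilsonRP.timeReflect_apply_zero,
      WilsonRP.shift_apply_self, Pi.single_eq_same]
    linear_combination (negRP_neg_half_eq (S := S))
  · simp only [Pi.sub_apply, WilsonSiteRP.negReflect_apply_of_ne _ hk,
      WilsonRP.timeReflect_apply_of_ne _ hk, WilsonRP.shift_apply_of_ne _ hk, Pi.single_eq_of_ne hk,
      sub_zero]

variable {G : Type*} [Group G] [MeasurableSpace G]

/-- **`Θ₀ ∘ τ = τ ∘ Θ₁`** for the half-torus time shift `τ = torusConfigShift (S e₀)` on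
`GaugeConfig 4 (2S+1) G`: the site reflection `t ↦ −t` is conjugate to the link reflection
`t ↦ 1 − t` of the odd torus. [cite: OsterwalderSeiler1978, §2] -/
theorem negRP_negReflect_halfShift (W : GaugeConfig 4 (2 * S + 1) G) :
    (torusConfigShift (Pi.single 0 ((S : ℕ) : ZMod (2 * S + 1))) W).negReflect =
      torusConfigShift (Pi.single 0 ((S : ℕ) : ZMod (2 * S + 1))) W.timeReflect := by
  funext e
  obtain ⟨x, i⟩ := e
  by_cases hi : i = 0
  · subst hi
    simp only [GaugeConfig.negReflect, GaugeConfig.timeReflect, torusConfigShift_apply, ↓reduceIte]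
    rw [negRP_negReflect_shift_sub_half]
  · simp only [GaugeConfig.negReflect, GaugeConfig.timeReflect, torusConfigShift_apply, hi,
      ↓reduceIte]
    rw [negRP_negReflect_sub_half]

omit [Group G] [MeasurableSpace G] in
/-- **Link bookkeeping.** For a `Θ₀`-positive link `e = (x, i)` of the torus of side `2S+1`
(`x⁰ ≤ S`, and `x⁰ < S` if `i = 0`), the link `edgeReflect (x − S e₀, i)` read by `τ ∘ Θ₁` lies in
the `Θ₁`-positive class `oPosEdges ∪ oSharedEdges` (spatial: time `S + 1 − x⁰ ∈ [1, S+1]`, the value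
`S+1` being the shared slice; temporal: time `S − x⁰ ∈ [1, S]`). [folklore] -/
theorem negRP_edgeReflect_mem (hS : 1 ≤ S) {e : Edge 4 (2 * S + 1)}
    (he : (e.1 0).val ≤ S ∧ (e.2 = 0 → (e.1 0).val < S)) :
    WilsonRP.edgeReflect (e.1 - Pi.single 0 ((S : ℕ) : ZMod (2 * S + 1)), e.2) ∈
      ((WilsonOddRP.oPosEdges ∪ WilsonOddRP.oSharedEdges : Finset (Edge 4 (2 * S + 1))) :
        Set (Edge 4 (2 * S + 1))) := by
  obtain ⟨x, i⟩ := e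
  obtain ⟨hxS, hx0⟩ := he
  simp only at hxS hx0
  have hdiv : (2 * S + 1) / 2 = S := by omega
  -- the time coordinate as a natural number
  set t : ℕ := (x 0).val with ht
  have hxt : x 0 = (t : ZMod (2 * S + 1)) := (ZMod.natCast_zmod_val (x 0)).symm
  rw [Finset.coe_union, Set.mem_union, Finset.mem_coe, Finset.mem_coe, WilsonOddRP.mem_oPosEdges,
    WilsonOddRP.mem_oSharedEdges]
  unfold WilsonOddRP.IsOPosEdge WilsonOddRP.IsOSharedEdge WilsonRP.edgeReflect
  by_cases hi : i = 0
  · subst hi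
    have htS : t < S := hx0 rfl
    have hval : ((((x - Pi.single 0 ((S : ℕ) : ZMod (2 * S + 1))).shift 0).timeReflect) 0).val
        = S - t := by
      rw [WilsonRP.timeReflect_apply_zero, WilsonRP.shift_apply_self, Pi.sub_apply, Pi.single_eq_same,
        hxt]
      have h1 : (1 : ZMod (2 * S + 1)) -
          ((t : ZMod (2 * S + 1)) - ((S : ℕ) : ZMod (2 * S + 1)) + 1) =
            ((S - t : ℕ) : ZMod (2 * S + 1)) := by
        rw [Nat.cast_sub htS.le]; ring
      rw [h1, ZMod.val_natCast_of_lt (by omega)]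
    simp only [↓reduceIte, hval, hdiv]
    exact Or.inl ⟨by omega, by omega⟩
  · have hval : (((x - Pi.single 0 ((S : ℕ) : ZMod (2 * S + 1))).timeReflect) 0).val
        = S + 1 - t := by
      rw [WilsonRP.timeReflect_apply_zero, Pi.sub_apply, Pi.single_eq_same, hxt]
      have h1 : (1 : ZMod (2 * S + 1)) - ((t : ZMod (2 * S + 1)) - ((S : ℕ) : ZMod (2 * S + 1))) =
          ((S + 1 - t : ℕ) : ZMod (2 * S + 1)) := by
        rw [Nat.cast_sub (by omega)]; push_cast; ring
      rw [h1, ZMod.val_natCast_of_lt (by omega)]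
    simp only [hi, ↓reduceIte, hval, hdiv]
    by_cases ht0 : t = 0
    · exact Or.inr ⟨hi, by omega⟩
    · exact Or.inl ⟨by omega, by omega⟩

end Geometry

/-! ## §2 Reflection positivity for the site reflection of the odd torus -/

section RP

variable {G : Type*} [Group G] [TopologicalSpace G] [IsTopologicalGroup G] [CompactSpace G]
  [MeasurableSpace G] [BorelSpace G] {N : ℕ} (ρ : G →* Matrix (Fin N) (Fin N) ℂ) {S : ℕ}

/-- **Osterwalder–Seiler reflection positivity of the odd Wilson torus for the SITE reflection.**
For continuous `ρ`, `β ≥ 0`, `S ≥ 1` and every bounded measurable `F` on `GaugeConfig 4 (2S+1) G`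
depending only on the `Θ₀`-positive links (base time `x⁰ ≤ S`, and `x⁰ < S` for temporal links — the
links of the closed half `0 ≤ t ≤ S + 1/2` of `Θ₀ : t ↦ −t`),
`0 ≤ ∫ conj F(Θ₀ U) · F(U) dμ_{Λ,β}` for `Θ₀ = GaugeConfig.negReflect`. Proof: conjugate to the
tree's `wilsonExpectation_oddReflectionPositive` (`Θ₁ = GaugeConfig.timeReflect`) by the
measure-preserving map `φ = τ_{S e₀} ∘ Θ₁`, `H = F ∘ φ`. [cite: OsterwalderSeiler1978, §2] -/
theorem wilsonExpectation_negReflect_nonneg_odd (hρ : Continuous ρ) {β : ℝ} (hβ : 0 ≤ β)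
    (hS : 1 ≤ S) (F : GaugeConfig 4 (2 * S + 1) G → ℂ) (hF : Measurable F)
    (hFb : ∃ C : ℝ, ∀ U, ‖F U‖ ≤ C)
    (hFd : DependsOn F {e : Edge 4 (2 * S + 1) | (e.1 0).val ≤ S ∧ (e.2 = 0 → (e.1 0).val < S)}) :
    0 ≤ wilsonExpectation ρ β fun U => conj (F U.negReflect) * F U := by
  -- the conjugating map `φ = τ_{S e₀} ∘ Θ₁`
  set φ : GaugeConfig 4 (2 * S + 1) G → GaugeConfig 4 (2 * S + 1) G :=
    fun V => torusConfigShift (Pi.single 0 ((S : ℕ) : ZMod (2 * S + 1))) V.timeReflect with hφ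
  have hΘm : Measurable (GaugeConfig.timeReflect : GaugeConfig 4 (2 * S + 1) G → _) :=
    WilsonRP.measurable_timeReflect
  have hΘ : MeasurePreserving (GaugeConfig.timeReflect : GaugeConfig 4 (2 * S + 1) G → _)
      (wilsonMeasure (d := 4) (L := 2 * S + 1) ρ β) (wilsonMeasure (d := 4) (L := 2 * S + 1) ρ β) :=
    ⟨hΘm, Summit.QuantumFields.YangMills.Theorems.FiniteSusceptibilityWeakCoupling.RPCauchySchwarz.wilsonMeasure_map_timeReflect
      ρ hρ β⟩
  have hτ : MeasurePreserving
      (⇑(torusConfigShift (G := G) (Pi.single 0 ((S : ℕ) : ZMod (2 * S + 1)) : Site 4 (2 * S + 1))))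
      (wilsonMeasure (d := 4) (L := 2 * S + 1) ρ β) (wilsonMeasure (d := 4) (L := 2 * S + 1) ρ β) :=
    ⟨(torusConfigShift _).measurable, wilsonMeasure_map_torusConfigShift ρ β _⟩
  have hφm : Measurable φ := (torusConfigShift _).measurable.comp hΘm
  have hφμ : MeasurePreserving φ (wilsonMeasure (d := 4) (L := 2 * S + 1) ρ β)
      (wilsonMeasure (d := 4) (L := 2 * S + 1) ρ β) := hτ.comp hΘ
  have hΘΘ : ∀ U : GaugeConfig 4 (2 * S + 1) G, U.timeReflect.timeReflect = U :=
    Summit.QuantumFields.YangMills.Theorems.FiniteSusceptibilityWeakCoupling.RPCauchySchwarz.timeReflect_timeReflect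
  -- `Θ₀ ∘ φ = τ` and `φ ∘ Θ₁ = τ`
  have hkey : ∀ V : GaugeConfig 4 (2 * S + 1) G,
      (φ V).negReflect = torusConfigShift (Pi.single 0 ((S : ℕ) : ZMod (2 * S + 1))) V := by
    intro V
    show (torusConfigShift _ V.timeReflect).negReflect = _
    rw [negRP_negReflect_halfShift, hΘΘ]
  have hφΘ : ∀ V : GaugeConfig 4 (2 * S + 1) G,
      φ V.timeReflect = torusConfigShift (Pi.single 0 ((S : ℕ) : ZMod (2 * S + 1))) V := by
    intro V
    show torusConfigShift _ V.timeReflect.timeReflect = _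
    rw [hΘΘ]
  -- the conjugated observable `H = F ∘ φ`
  set H : GaugeConfig 4 (2 * S + 1) G → ℂ := F ∘ φ with hH
  have hHm : Measurable H := hF.comp hφm
  obtain ⟨C, hC⟩ := hFb
  have hHb : ∃ C : ℝ, ∀ U, ‖H U‖ ≤ C := ⟨C, fun U => hC _⟩
  have hHd : DependsOn H ((WilsonOddRP.oPosEdges ∪ WilsonOddRP.oSharedEdges :
      Finset (Edge 4 (2 * S + 1))) : Set (Edge 4 (2 * S + 1))) := by
    intro V V' hVV'
    simp only [hH, Function.comp_apply, hφ]
    apply hFd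
    intro e he
    rw [torusConfigShift_apply, torusConfigShift_apply, WilsonRP.timeReflect_apply,
      WilsonRP.timeReflect_apply, hVV' _ (negRP_edgeReflect_mem hS he)]
  have hRP := wilsonExpectation_oddReflectionPositive ρ ⟨S, by ring⟩ (by omega) hρ hβ H hHm hHb hHd
  -- change of variables along `φ`
  have hg : Measurable fun U : GaugeConfig 4 (2 * S + 1) G => conj (F U.negReflect) * F U :=
    (Complex.continuous_conj.measurable.comp (hF.comp WilsonSiteRP.measurable_negReflect)).mul hF
  have hpt : ∀ V, conj (F (φ V).negReflect) * F (φ V) = conj (H V.timeReflect) * H V := by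
    intro V
    simp only [hH, Function.comp_apply, hkey, hφΘ]
  unfold wilsonExpectation at hRP ⊢
  rw [← Literature.MathematicalPhysics.QuantumLattice.integral_comp_eq_of_measurePreserving hφμ hg,
    integral_congr_ae (ae_of_all _ hpt)]
  exact hRP

/-- **stub_negReflectRP** (corrected slab form) — reflection positivity of the ODD Wilson torus for
the SITE reflection `Θ₀ = GaugeConfig.negReflect` (`t ↦ −t`) on slab observables: for continuous
`ρ`, `β ≥ 0`, `S ≥ 1` and every bounded measurable `F` on `GaugeConfig 4 (2S+1) G` depending only on
the links based at lattice times `1 … w` with `w < S` (so that no temporal link crosses the fixed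
link plane between `S` and `S+1`), `0 ≤ ∫ conj F(Θ₀U) · F(U) dμ_{Λ,β}`.
(`w ≤ S` is false: the temporal links `S → S+1` are reversed by `Θ₀`.)
[cite: OsterwalderSeiler1978, §2] -/
theorem stub_negReflectRP :
    ∀ {G : Type} [Group G] [TopologicalSpace G] [IsTopologicalGroup G] [CompactSpace G]
      [MeasurableSpace G] [BorelSpace G] {N : ℕ} (ρ : G →* Matrix (Fin N) (Fin N) ℂ), Continuous ρ →
      ∀ {β : ℝ}, 0 ≤ β → ∀ {S : ℕ}, 1 ≤ S → ∀ (F : GaugeConfig 4 (2 * S + 1) G → ℂ), Measurable F →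
        (∃ C : ℝ, ∀ U, ‖F U‖ ≤ C) → ∀ {w : ℕ}, w < S →
        DependsOn F {e : Edge 4 (2 * S + 1) | 1 ≤ (e.1 0).val ∧ (e.1 0).val ≤ w} →
          0 ≤ wilsonExpectation ρ β fun U => conj (F U.negReflect) * F U := by
  intro G _ _ _ _ _ _ N ρ hρ β hβ S hS F hF hFb w hw hFd
  refine wilsonExpectation_negReflect_nonneg_odd ρ hρ hβ hS F hF hFb (hFd.mono ?_)
  intro e he
  simp only [Set.mem_setOf_eq] at he ⊢
  exact ⟨by omega, fun _ => by omega⟩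

end RP

end Summit.QuantumFields.YangMills.Cruxes.LatticeGapOnTrajectory.OrbitKantorovichFiniteSize

end
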